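import Mathlib
import Literature.Barriers.ValiantsHypothesis.PartialDerivativesDetPerm
import Literature.Computability.AlgebraicComplexity.BLMW11WeakValiantHypothesis
import Summits.ValiantsHypothesis.ValiantsHypothesis.Theorems.GrenetZeonTwoDimCoefficientsDualUnipotentCommutative

/-!
# Crux `GrenetZeon.TwoDimCoefficients` (stmt-ValiantsHypothesis-8062), stub `stub_dualUnipotent`:
# the commutative rung in the stub's NATIVE currency — `DualUnipotentRepr` with a commutative matrix `A`

✓ `…DualUnipotentCommutative.lean` (this seat) proves the stub's bound on the commutative locus in PENCIL
currency (`per_n = tr(N^{n−1}·M)`, the `[x_c]N` commuting).  This file proves it in the currency of the stub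
ITSELF: `DualUnipotentBound` quantifies over `DualUnipotentRepr n m`, i.e. over
`per_n = α·det A + β·tr(adj A·B)` with `A`, `B` affine `m × m` and `det A ≡ c ≠ 0`.  If the COEFFICIENT MATRICES of
`A` (the constant one `[1]A` and the linear ones `[x_c]A`) pairwise commute, then

* `choose_sq_le_of_dualUnipotentRepr_commutative` — `C(n,k)² ≤ (n² + 1)·m²` for every `k ≥ 1`;
* `sq_le_of_dualUnipotentRepr_commutative` — `n² ≤ 17·m` (`n ≥ 4`);
* `dualUnipotentBound_of_commutative_repr` — ★ `DualUnipotentBound` with the single extra conjunct «the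
  coefficient matrices of `A` commute» inside `DualUnipotentRepr`, `C = 17`, `n₀ = 4`.

No normal form is needed: with `Q := A⁻¹` (a polynomial matrix, `det A` being a unit) one has
`adj A = c·Q`, `∂_c Q = −[x_c]A·Q²` (differentiate `A·Q = 1`; `[x_c]A` commutes with `A`, hence with `Q`), so
`∂_c Q^{s+1} = −(s+1)·[x_c]A·Q^{s+2}` and the CHAIN ENGINE `finrank_span_derivSet_trace_chain_mul_le` (a
sequence of polynomial matrices `P_s` with `∂_c P_s = L_{s,c}·P_{s+1}`, `L_{s,c}` constant, and an affine `B`: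
the `k`-th order partials of `tr(P_0·B)` lie in the span of the `(n²+1)·m²` entries of `P_k·B`, `P_{k−1}·[x_d]B`)
applies to `P_s = Q^{s+1}`; the `k`-th flattening of `per_n` has rank `C(n,k)²`
(✓ `Literature.Barriers.ValiantsHypothesis.flatteningRank_perPoly`).

HONEST FRAMING: a sub-case rung (def-free helper, `--supports stmt-ValiantsHypothesis-8062`); the stub, the crux (an
ASIDE item), 24318 and `VP ≠ VNP` are NOT proved; the open core of the stub is the NON-commutative pencil.

References: J. M. Landsberg, *Geometry and Complexity Theory* (CUP 2017), Exercise 6.2.2.7; A. Iarrobino,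
V. Kanev, LNM 1721 (1999), Ch. 1.
-/

-- single-conjunct layout: the duplicated namespace component is mandated by the tree.
set_option linter.dupNamespace false

noncomputable section

namespace Summit.ValiantsHypothesis.ValiantsHypothesis.Cruxes.TwoDimCoefficients.DimTwoCases

open MvPolynomial Matrix
open Literature.Computability.AlgebraicComplexity
open Literature.Barriers.ValiantsHypothesis (iterPDeriv derivSet shiftedPartialsRank_zero_eq
  flatteningRank_perPoly iterPDeriv_nil iterPDeriv_cons iterPDeriv_add iterPDeriv_smul)

namespace CommutativePencil

variable {σ : Type} {ι : Type}

/-! ### The chain engine -/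

/-- ★ CHAIN ENGINE.  Let `P : ℕ → M_ι(ℂ[x])` be polynomial matrices with `∂_c P_s = L_{s,c}·P_{s+1}` for CONSTANT
matrices `L_{s,c}`, and `B` a polynomial matrix with constant derivatives `∂_c B = B_c`.  Then for every `k` the
`k`-th order partials of `tr(X·B)`, `X = P_0`, span a space of dimension `≤ (#σ + 1)·(#ι)²`: they lie in the span `V_k` of
the entries of `P_k·B` and `P_{k−1}·B_d` (`d ∈ σ`; absent for `k = 0`), and `∂_c V_k ⊆ V_{k+1}`. [folklore] -/
theorem finrank_span_derivSet_trace_chain_mul_le [Fintype σ] [DecidableEq σ] [Fintype ι] [DecidableEq ι]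
    {P : ℕ → Matrix ι ι (MvPolynomial σ ℂ)} {B : Matrix ι ι (MvPolynomial σ ℂ)}
    {L : ℕ → σ → Matrix ι ι ℂ} {Bc : σ → Matrix ι ι ℂ}
    (hP : ∀ s c, (P s).map (pderiv c) = (L s c).map C * P (s + 1))
    (hB : ∀ c, B.map (pderiv c) = (Bc c).map C) {X : Matrix ι ι (MvPolynomial σ ℂ)} (hX : P 0 = X) (k : ℕ) :
    Module.finrank ℂ (Submodule.span ℂ (derivSet k (X * B).trace)) ≤
      (Fintype.card σ + 1) * Fintype.card ι ^ 2 := by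
  subst hX
  /- (0) the shifted sequence `R 0 = 0`, `R (s+1) = P s` indexing the shapes in which `B` has been hit -/
  obtain ⟨R, R_zero, R_succ⟩ : ∃ R : ℕ → Matrix ι ι (MvPolynomial σ ℂ), R 0 = 0 ∧ ∀ s, R (s + 1) = P s :=
    ⟨fun s => Nat.rec 0 (fun s _ => P s) s, rfl, fun _ => rfl⟩
  /- (1) generators of `V_k`: entries of `P_k·B` (index `none`) and of `R_k·B_d` (index `some d`) -/
  obtain ⟨g, g_none, g_some⟩ : ∃ g : ℕ → Option σ × ι × ι → MvPolynomial σ ℂ,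
      (∀ k a b, g k (none, a, b) = (P k * B) a b) ∧
      (∀ k d a b, g k (some d, a, b) = (R k * (Bc d).map (C : ℂ → MvPolynomial σ ℂ)) a b) :=
    ⟨fun k p => p.1.elim ((P k * B) p.2.1 p.2.2)
        fun d => (R k * (Bc d).map (C : ℂ → MvPolynomial σ ℂ)) p.2.1 p.2.2,
      fun _ _ _ => rfl, fun _ _ _ _ => rfl⟩
  /- (2) left multiplication by a CONSTANT matrix preserves «all entries of a column lie in V» -/
  have hrow : ∀ (k : ℕ) (K : Matrix ι ι ℂ) (X : Matrix ι ι (MvPolynomial σ ℂ)) (a b : ι),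
      (∀ x, X x b ∈ Submodule.span ℂ (Set.range (g k))) →
      (K.map (C : ℂ → MvPolynomial σ ℂ) * X) a b ∈ Submodule.span ℂ (Set.range (g k)) := by
    intro k K X a b hX
    rw [Matrix.mul_apply]
    refine Submodule.sum_mem _ fun x _ => ?_
    rw [Matrix.map_apply, ← smul_eq_C_mul]
    exact Submodule.smul_mem _ _ (hX x)
  /- (3) one derivative `∂_c` maps every generator of `V_k` into `V_{k+1}` -/
  have hgen : ∀ (k : ℕ) (c : σ) (p : Option σ × ι × ι),
      pderiv c (g k p) ∈ Submodule.span ℂ (Set.range (g (k + 1))) := by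
    rintro k c ⟨o, a, b⟩
    cases o with
    | none =>
      -- `∂_c (P_k B)_{ab} = (L_{k,c} P_{k+1} B)_{ab} + (P_k B_c)_{ab}`
      rw [g_none]
      change ((P k * B).map (pderiv c)) a b ∈ _
      rw [TraceChain.map_pderiv_mul, hP k c, hB c, Matrix.add_apply]
      refine Submodule.add_mem _ ?_ ?_
      · rw [Matrix.mul_assoc]
        refine hrow (k + 1) (L k c) (P (k + 1) * B) a b fun x => ?_
        exact Submodule.subset_span ⟨(none, x, b), by rw [g_none]⟩
      · exact Submodule.subset_span ⟨(some c, a, b), by rw [g_some, R_succ]⟩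
    | some d =>
      rw [g_some]
      cases k with
      | zero =>
        rw [R_zero, Matrix.zero_mul, Matrix.zero_apply, map_zero]
        exact Submodule.zero_mem _
      | succ k =>
        -- `∂_c (P_k B_d)_{ab} = (L_{k,c} P_{k+1} B_d)_{ab}`
        rw [R_succ]
        change ((P k * (Bc d).map (C : ℂ → MvPolynomial σ ℂ)).map (pderiv c)) a b ∈ _
        rw [TraceChain.map_pderiv_mul, hP k c, TraceChain.map_pderiv_map_C, Matrix.mul_zero, add_zero,
          Matrix.mul_assoc]
        refine hrow (k + 1 + 1) (L k c) (P (k + 1) * (Bc d).map (C : ℂ → MvPolynomial σ ℂ)) a b fun x => ?_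
        exact Submodule.subset_span ⟨(some d, x, b), by rw [g_some, R_succ]⟩
  /- (4) hence `∂_c V_k ⊆ V_{k+1}` -/
  have hV : ∀ (k : ℕ) (c : σ), ∀ x ∈ Submodule.span ℂ (Set.range (g k)),
      pderiv c x ∈ Submodule.span ℂ (Set.range (g (k + 1))) := by
    intro k c x hx
    induction hx using Submodule.span_induction with
    | mem x hx =>
      obtain ⟨p, rfl⟩ := hx
      exact hgen k c p
    | zero =>
      rw [map_zero]
      exact Submodule.zero_mem _
    | add x y _ _ hx hy =>
      rw [map_add]
      exact Submodule.add_mem _ hx hy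
    | smul a x _ hx =>
      rw [Derivation.map_smul]
      exact Submodule.smul_mem _ _ hx
  /- (5) iterate: `k` derivatives map `V_0` into `V_k` -/
  have hiter : ∀ (l : List σ), ∀ x ∈ Submodule.span ℂ (Set.range (g 0)),
      iterPDeriv l x ∈ Submodule.span ℂ (Set.range (g l.length)) := by
    intro l
    induction l with
    | nil =>
      intro x hx
      simpa only [iterPDeriv_nil, List.length_nil] using hx
    | cons c l ih =>
      intro x hx
      rw [iterPDeriv_cons, List.length_cons]
      exact hV _ c _ (ih x hx)
  /- (6) `tr(P_0 · B) ∈ V_0` -/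
  have hbase : (P 0 * B).trace ∈ Submodule.span ℂ (Set.range (g 0)) := by
    rw [Matrix.trace]
    refine Submodule.sum_mem _ fun a _ => Submodule.subset_span ⟨(none, a, a), ?_⟩
    rw [g_none, Matrix.diag_apply]
  /- (7) count generators -/
  have hspan : Submodule.span ℂ (derivSet k (P 0 * B).trace) ≤ Submodule.span ℂ (Set.range (g k)) := by
    rw [Submodule.span_le]
    rintro _ ⟨l, hl, rfl⟩
    have h := hiter l _ hbase
    rw [hl] at h
    exact h
  haveI : Module.Finite ℂ (Submodule.span ℂ (Set.range (g k))) :=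
    Module.Finite.span_of_finite ℂ (Set.finite_range _)
  calc Module.finrank ℂ (Submodule.span ℂ (derivSet k (P 0 * B).trace))
      ≤ Module.finrank ℂ (Submodule.span ℂ (Set.range (g k))) := Submodule.finrank_mono hspan
    _ ≤ Fintype.card (Option σ × ι × ι) := finrank_range_le_card (g k)
    _ = (Fintype.card σ + 1) * Fintype.card ι ^ 2 := by
        rw [Fintype.card_prod, Fintype.card_prod, Fintype.card_option, pow_two]

/-! ### Affine matrices: derivatives and commutation of the coefficient matrices -/

/-- For an AFFINE polynomial `p` (total degree `≤ 1`), `∂_c p` is the constant `[x_c] p`. [folklore] -/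
theorem pderiv_eq_C_coeff_of_totalDegree_le_one [Fintype σ] [DecidableEq σ] {p : MvPolynomial σ ℂ}
    (hp : p.totalDegree ≤ 1) (c : σ) : pderiv c p = C (coeff (Finsupp.single c 1) p) := by
  have hp' := eq_C_add_sum_smul_X_of_totalDegree_le_one hp
  conv_lhs => rw [hp']
  rw [map_add, pderiv_C, zero_add, map_sum, Finset.sum_eq_single c]
  · rw [Derivation.map_smul, pderiv_X, Pi.single_eq_same, smul_eq_C_mul, mul_one]
  · intro t _ htc
    rw [Derivation.map_smul, pderiv_X, Pi.single_eq_of_ne htc, smul_zero]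
  · intro h
    exact absurd (Finset.mem_univ c) h

/-- The matrix of `∂_c` of an AFFINE matrix is the constant coefficient matrix `[x_c]A`. [folklore] -/
theorem map_pderiv_of_isAffine [Fintype σ] [DecidableEq σ] {A : Matrix ι ι (MvPolynomial σ ℂ)}
    (hA : ∀ i j, (A i j).totalDegree ≤ 1) (c : σ) :
    A.map (pderiv c) = (A.map (coeff (Finsupp.single c 1))).map C :=
  Matrix.ext fun i j => by
    simp only [Matrix.map_apply]
    exact pderiv_eq_C_coeff_of_totalDegree_le_one (hA i j) c

/-- An affine matrix is `[1]A + Σ_t x_t · [x_t]A`. [folklore] -/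
theorem eq_C_add_sum_X_smul_of_isAffine [Fintype σ] [DecidableEq σ] {A : Matrix ι ι (MvPolynomial σ ℂ)}
    (hA : ∀ i j, (A i j).totalDegree ≤ 1) :
    A = (A.map (coeff 0)).map C + ∑ t : σ, (X t : MvPolynomial σ ℂ) • (A.map (coeff (Finsupp.single t 1))).map C :=
  Matrix.ext fun i j => by
    rw [Matrix.add_apply, Matrix.sum_apply]
    simp only [Matrix.smul_apply, Matrix.map_apply, smul_eq_mul]
    conv_lhs => rw [eq_C_add_sum_smul_X_of_totalDegree_le_one (hA i j)]
    exact congrArg _ (Finset.sum_congr rfl fun t _ => by rw [smul_eq_C_mul, mul_comm])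

/-- If ALL coefficient matrices of an affine matrix pairwise commute, each linear coefficient matrix commutes with
the matrix. [folklore] -/
theorem commute_coeff_of_isAffine [Fintype σ] [DecidableEq σ] [Fintype ι] [DecidableEq ι]
    {A : Matrix ι ι (MvPolynomial σ ℂ)} (hA : ∀ i j, (A i j).totalDegree ≤ 1)
    (hcomm : ∀ d₁ d₂ : σ →₀ ℕ, Commute (A.map (coeff d₁)) (A.map (coeff d₂))) (c : σ) :
    Commute ((A.map (coeff (Finsupp.single c 1))).map (C : ℂ → MvPolynomial σ ℂ)) A := by
  have hmapC : ∀ d₁ d₂ : σ →₀ ℕ, Commute ((A.map (coeff d₁)).map (C : ℂ → MvPolynomial σ ℂ))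
      ((A.map (coeff d₂)).map (C : ℂ → MvPolynomial σ ℂ)) := fun d₁ d₂ => by
    simpa only [RingHom.mapMatrix_apply] using (hcomm d₁ d₂).map (C : ℂ →+* MvPolynomial σ ℂ).mapMatrix
  have key : Commute ((A.map (coeff (Finsupp.single c 1))).map (C : ℂ → MvPolynomial σ ℂ))
      ((A.map (coeff 0)).map C +
        ∑ t : σ, (X t : MvPolynomial σ ℂ) • (A.map (coeff (Finsupp.single t 1))).map C) :=
    Commute.add_right (hmapC _ _)
      (Commute.sum_right _ _ _ fun t _ => Commute.smul_right (hmapC _ _) _)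
  rwa [← eq_C_add_sum_X_smul_of_isAffine hA] at key

/-! ### Iterated derivatives of `C a + C b · f` -/

/-- A non-trivial iterated derivative kills constants. [folklore] -/
theorem iterPDeriv_cons_C (a : ℂ) (l : List σ) (i : σ) : iterPDeriv (i :: l) (C a : MvPolynomial σ ℂ) = 0 := by
  induction l generalizing i with
  | nil => rw [iterPDeriv_cons, iterPDeriv_nil, pderiv_C]
  | cons j l ih => rw [iterPDeriv_cons, ih j, map_zero]

/-- `∂^l (C a + C b · f) = C b · ∂^l f` for a non-empty list `l`. [folklore] -/
theorem iterPDeriv_C_add_C_mul_of_ne_nil (a b : ℂ) (f : MvPolynomial σ ℂ) {l : List σ} (hl : l ≠ []) :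
    iterPDeriv l (C a + C b * f) = C b * iterPDeriv l f := by
  obtain ⟨i, l, rfl⟩ := List.exists_cons_of_ne_nil hl
  rw [iterPDeriv_add, iterPDeriv_cons_C, zero_add, ← smul_eq_C_mul, iterPDeriv_smul, smul_eq_C_mul]

/-- Over finitely many variables the set of `k`-th order iterated partials is finite. [folklore] -/
theorem finite_derivSet [Finite σ] (k : ℕ) (f : MvPolynomial σ ℂ) : (derivSet k f).Finite :=
  ((List.finite_length_eq σ k).image fun l => iterPDeriv l f).subset (by
    rintro _ ⟨l, hl, rfl⟩
    exact ⟨l, hl, rfl⟩)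

/-- The `k`-th flattening (`k ≥ 1`) of `C a + C b · f` has rank at most that of `f`. [folklore] -/
theorem finrank_span_derivSet_C_add_C_mul_le [Finite σ] (a b : ℂ) (f : MvPolynomial σ ℂ) {k : ℕ} (hk : 1 ≤ k) :
    Module.finrank ℂ (Submodule.span ℂ (derivSet k (C a + C b * f))) ≤
      Module.finrank ℂ (Submodule.span ℂ (derivSet k f)) := by
  have hle : Submodule.span ℂ (derivSet k (C a + C b * f)) ≤
      (Submodule.span ℂ (derivSet k f)).map (LinearMap.mulLeft ℂ (C b : MvPolynomial σ ℂ)) := by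
    rw [Submodule.span_le]
    rintro _ ⟨l, hl, rfl⟩
    have hne : l ≠ [] := by
      rintro rfl
      simp at hl
      omega
    rw [iterPDeriv_C_add_C_mul_of_ne_nil a b f hne]
    exact Submodule.mem_map_of_mem (Submodule.subset_span ⟨l, hl, rfl⟩)
  haveI : Module.Finite ℂ (Submodule.span ℂ (derivSet k f)) := Module.Finite.span_of_finite ℂ (finite_derivSet k f)
  exact (Submodule.finrank_mono hle).trans (Submodule.finrank_map_le _ _)

end CommutativePencil

open CommutativePencil

/-! ### ★ The commutative rung in the currency of `DualUnipotentRepr` -/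

variable {n m : ℕ}

/-- ★ **COMMUTATIVE RUNG, native currency (flattening form).**  Let `per_n = α·det A + β·tr(adj A·B)` with `A`, `B`
affine `m × m`, `det A ≡ c ≠ 0` (the data of `DualUnipotentRepr n m`), and suppose that ALL coefficient matrices
of `A` pairwise commute.  Then `C(n,k)² ≤ (n² + 1)·m²` for every `k ≥ 1`.  (With `Q = A⁻¹`: `adj A = c·Q`,
`∂_c Q^{s+1} = −(s+1)·[x_c]A·Q^{s+2}`, chain engine; flattening rank of `per_n` ✓ `flatteningRank_perPoly`.)
[cite: LandsbergGCT2017, Exercise 6.2.2.7 (p. 159)] -/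
theorem choose_sq_le_of_dualUnipotentRepr_commutative {α β c : ℂ} {A B : AffMat n m} (hA : IsAffine A)
    (hB : IsAffine B) (hc : c ≠ 0) (hdet : A.det = C c)
    (hper : perPoly (Fin n) ℂ = C α * A.det + C β * (A.adjugate * B).trace)
    (hcomm : ∀ d₁ d₂ : (Fin n × Fin n) →₀ ℕ, Commute (A.map (coeff d₁)) (A.map (coeff d₂)))
    {k : ℕ} (hk : 1 ≤ k) : (n.choose k) ^ 2 ≤ (n ^ 2 + 1) * m ^ 2 := by
  -- the inverse `Q` of `A` over `ℂ[x]`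
  have hAu : IsUnit A.det := by rw [hdet]; exact (isUnit_iff_ne_zero.2 hc).map C
  set Q : AffMat n m := A⁻¹ with hQ
  have hAQ : A * Q = 1 := Matrix.mul_nonsing_inv A hAu
  have hQA : Q * A = 1 := Matrix.nonsing_inv_mul A hAu
  -- coefficient matrices
  set Ac : Fin n × Fin n → Matrix (Fin m) (Fin m) ℂ := fun c => A.map (coeff (Finsupp.single c 1)) with hAc
  have hdA : ∀ c, A.map (pderiv c) = (Ac c).map C := fun c => map_pderiv_of_isAffine hA c
  have hcA : ∀ c, Commute ((Ac c).map (C : ℂ → MvPolynomial (Fin n × Fin n) ℂ)) A :=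
    fun c => commute_coeff_of_isAffine hA hcomm c
  -- `[x_c]A` commutes with `Q`
  have hcQ : ∀ c, Commute ((Ac c).map (C : ℂ → MvPolynomial (Fin n × Fin n) ℂ)) Q := by
    intro c
    have h : Q * (Ac c).map C = (Ac c).map C * Q := by
      calc Q * (Ac c).map C = Q * (Ac c).map C * (A * Q) := by rw [hAQ, Matrix.mul_one]
        _ = Q * ((Ac c).map C * A) * Q := by simp only [Matrix.mul_assoc]
        _ = Q * (A * (Ac c).map C) * Q := by rw [(hcA c).eq]
        _ = Q * A * (Ac c).map C * Q := by simp only [Matrix.mul_assoc]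
        _ = (Ac c).map C * Q := by rw [hQA, Matrix.one_mul]
    exact h.symm
  -- `∂_c Q = −[x_c]A · Q²`
  have hdQ : ∀ c, Q.map (pderiv c) = -((Ac c).map C * (Q * Q)) := by
    intro c
    have h : (A * Q).map (pderiv c) = (1 : AffMat n m).map (pderiv c) := by rw [hAQ]
    rw [TraceChain.map_pderiv_mul, map_pderiv_one, hdA c] at h
    -- `h : [x_c]A·Q + A·∂Q = 0`
    have h2 : A * Q.map (pderiv c) = -((Ac c).map C * Q) := (neg_eq_of_add_eq_zero_right h).symm
    calc Q.map (pderiv c) = Q * (A * Q.map (pderiv c)) := by rw [← Matrix.mul_assoc, hQA, Matrix.one_mul]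
      _ = -(Q * ((Ac c).map C * Q)) := by rw [h2, Matrix.mul_neg]
      _ = -((Ac c).map C * (Q * Q)) := by rw [← Matrix.mul_assoc, ← (hcQ c).eq, Matrix.mul_assoc]
  -- the chain `P_s = Q^{s+1}`: `∂_c Q^{s+1} = (−(s+1)·[x_c]A) · Q^{s+2}`
  have hP : ∀ (s : ℕ) (c : Fin n × Fin n), (Q ^ (s + 1)).map (pderiv c) =
      (-((s + 1) • Ac c)).map C * Q ^ (s + 1 + 1) := by
    intro s c
    have hD : Commute (-((Ac c).map (C : ℂ → MvPolynomial (Fin n × Fin n) ℂ) * (Q * Q))) Q :=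
      ((hcQ c).mul_left ((Commute.refl Q).mul_left (Commute.refl Q))).neg_left
    rw [map_pderiv_pow_succ c Q _ (hdQ c) hD s]
    have hneg : (-((s + 1) • Ac c)).map (C : ℂ → MvPolynomial (Fin n × Fin n) ℂ) =
        -((s + 1) • (Ac c).map C) := by
      refine Matrix.ext fun i j => ?_
      simp only [Matrix.map_apply, Matrix.neg_apply, Matrix.smul_apply, map_neg, map_nsmul]
    rw [hneg, Matrix.neg_mul, Matrix.neg_mul, smul_neg, smul_mul_assoc, pow_succ' Q (s + 1), pow_succ' Q s]
    simp only [Matrix.mul_assoc]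
  -- `per_n = C(αc) + C(βc) · tr(Q·B)`
  have hadj : A.adjugate = (C c : MvPolynomial (Fin n × Fin n) ℂ) • Q := by
    rw [adjugate_eq_det_smul_inv A hAu, hdet]
  have hper' : perPoly (Fin n) ℂ = C (α * c) + C (β * c) * (Q * B).trace := by
    rw [hper, hdet, hadj, Matrix.smul_mul, Matrix.trace_smul, smul_eq_mul, map_mul, map_mul, mul_assoc]
  -- flattenings
  have h1 := flatteningRank_perPoly ℂ n k
  rw [shiftedPartialsRank_zero_eq, hper'] at h1
  have hchain := finrank_span_derivSet_trace_chain_mul_le (P := fun s => Q ^ (s + 1)) (B := B)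
    (L := fun s c => -((s + 1) • Ac c)) hP (map_pderiv_of_isAffine hB) (X := Q) (pow_one Q) k
  simp only [Fintype.card_prod, Fintype.card_fin] at hchain
  have h2 := finrank_span_derivSet_C_add_C_mul_le (α * c) (β * c) (Q * B).trace hk
  rw [h1] at h2
  calc (n.choose k) ^ 2 ≤ Module.finrank ℂ (Submodule.span ℂ (derivSet k (Q * B).trace)) := h2
    _ ≤ (n * n + 1) * m ^ 2 := hchain
    _ = (n ^ 2 + 1) * m ^ 2 := by rw [← pow_two]

/-- ★ **COMMUTATIVE RUNG, native currency (the stub's shape).**  `DualUnipotentRepr` data with pairwise commuting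
coefficient matrices of `A` force `n² ≤ 17·m` (`n ≥ 4`). [folklore] -/
theorem sq_le_of_dualUnipotentRepr_commutative (hn : 4 ≤ n) {α β c : ℂ} {A B : AffMat n m} (hA : IsAffine A)
    (hB : IsAffine B) (hc : c ≠ 0) (hdet : A.det = C c)
    (hper : perPoly (Fin n) ℂ = C α * A.det + C β * (A.adjugate * B).trace)
    (hcomm : ∀ d₁ d₂ : (Fin n × Fin n) →₀ ℕ, Commute (A.map (coeff d₁)) (A.map (coeff d₂))) : n ^ 2 ≤ 17 * m :=
  sq_le_seventeen_mul_of_choose_three hn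
    (choose_sq_le_of_dualUnipotentRepr_commutative hA hB hc hdet hper hcomm (by norm_num : 1 ≤ 3))

/-- ★ **`DualUnipotentBound` ON THE COMMUTATIVE LOCUS, native currency.**  The statement `DualUnipotentBound`
(`∃ C n₀, ∀ n ≥ n₀, ∀ m, DualUnipotentRepr n m → n² ≤ C·m`) with `DualUnipotentRepr n m` unfolded VERBATIM and ONE
extra conjunct — the coefficient matrices of `A` pairwise commute — holds with `C = 17`, `n₀ = 4`.  The open core
of `stub_dualUnipotent` is the representation by a NON-commutative affine matrix `A`. [folklore] -/
theorem dualUnipotentBound_of_commutative_repr :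
    ∃ C n₀ : ℕ, ∀ n ≥ n₀, ∀ m : ℕ,
      (∃ (α β c : ℂ) (A B : AffMat n m), IsAffine A ∧ IsAffine B ∧ c ≠ 0 ∧ A.det = MvPolynomial.C c ∧
        perPoly (Fin n) ℂ = MvPolynomial.C α * A.det + MvPolynomial.C β * (A.adjugate * B).trace ∧
        ∀ d₁ d₂ : (Fin n × Fin n) →₀ ℕ, Commute (A.map (coeff d₁)) (A.map (coeff d₂))) →
      n ^ 2 ≤ C * m := by
  refine ⟨17, 4, fun n hn m h => ?_⟩
  obtain ⟨α, β, c, A, B, hA, hB, hc, hdet, hper, hcomm⟩ := h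
  exact sq_le_of_dualUnipotentRepr_commutative hn hA hB hc hdet hper hcomm

/-- The commutative representations ARE unipotent dual representations (sanity: the locus is a sub-locus of the
stub's hypothesis, dropping the extra conjunct). [folklore] -/
theorem dualUnipotentRepr_of_commutative_repr {α β c : ℂ} {A B : AffMat n m} (hA : IsAffine A) (hB : IsAffine B)
    (hc : c ≠ 0) (hdet : A.det = C c) (hper : perPoly (Fin n) ℂ = C α * A.det + C β * (A.adjugate * B).trace) :
    DualUnipotentRepr n m :=
  ⟨α, β, c, A, B, hA, hB, hc, hdet, hper⟩

end Summit.ValiantsHypothesis.ValiantsHypothesis.Cruxes.TwoDimCoefficients.DimTwoCases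

end
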